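import Summits.AtomisticToContinuum.FouriersLaw.Theorems.CurrentTiltQuenchBridgeGlue
import Summits.AtomisticToContinuum.FouriersLaw.Theorems.JunctionLocalityNonBallisticOfNoTruncatedDrude

/-!
# The finest FILED reduction of `JunctionLocality.NonBallistic` (stmt-AtomisticToContinuum-9127) — through the CurrentTiltQuench cruxes

Lead c4 of crux stmt-9127, line `drude-controls-conductance` (helper file, `--supports stmt-AtomisticToContinuum-9127`; nothing here closes
the item). The landed deciding reduction of the line,
`NonBallistic.nonBallistic_of_extensiveSnapshotIrreversibility_of_noTruncatedDrude : (K) → NoTruncatedDrude → NonBallistic` (p156168), composed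
with the bridge of route CurrentTiltQuench (`CurrentTiltQuench.bridgeGlue_proof`, stmt-9190), gives

`NonBallistic ⟸ ExtensiveSnapshotIrreversibility (stmt-9121) ∧ UniformQuadraticResponse (stmt-11026) ∧ QuenchCurrentDies (stmt-11028)
  ∧ BoundedOddRigidity (stmt-11027)`:

the crux of routes JunctionLocality / PuiseuxTransferLedger (support of BondHeatUncertainty; one decl text) is kernel-reduced to FOUR FILED
CRUX ITEMS of routes BondHeatUncertainty and CurrentTiltQuench. Reading for planners: the anharmonic content of stmt-9127 sits in 11026
(uniform-in-time second-order quench response) and 11027 (odd-sector macro-ergodicity of the infinite pinned chain = the catalogued barrier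
in its weakest form); 11028 is a Krylov–Bogoliubov/entropy compactness step; 9121 is NESS statics (harmonic-true). Every other ingredient
(total-current FTUR, fixed-time thermodynamic limit of the open chain onto the infinite chain, truncation removal, the bridge) is a theorem.
-/

namespace Summit.AtomisticToContinuum.FouriersLaw.Theorems.NonBallistic

/-- **The finest FILED reduction of the crux `NonBallistic` (stmt-AtomisticToContinuum-9127).** Under weak-NESS uniqueness, for every
steady-state family of the pinned anharmonic chain, every `T > 0` and response coefficients `D_N`, the conductance `D_N/(N-1)` is not
bounded away from `0` — PROVIDED (K) `ExtensiveSnapshotIrreversibility` (stmt-9121, route BondHeatUncertainty) and the three cruxes of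
route CurrentTiltQuench hold: `UniformQuadraticResponse` (stmt-11026), `QuenchCurrentDies` (stmt-11028), `BoundedOddRigidity`
(stmt-11027). Composition of `CurrentTiltQuench.bridgeGlue_proof` (stmt-9190) with the landed deciding reduction of line `drude-controls-conductance`
(`NonBallistic.nonBallistic_of_extensiveSnapshotIrreversibility_of_noTruncatedDrude`, p156168). [folklore] -/
theorem nonBallistic_of_extensiveSnapshotIrreversibility_of_currentTiltQuenchCruxes :
    Summit.AtomisticToContinuum.FouriersLaw.Theses.BondHeatUncertainty.ExtensiveSnapshotIrreversibility →
    Summit.AtomisticToContinuum.FouriersLaw.Theses.CurrentTiltQuench.UniformQuadraticResponse →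
    Summit.AtomisticToContinuum.FouriersLaw.Theses.CurrentTiltQuench.QuenchCurrentDies →
    Summit.AtomisticToContinuum.FouriersLaw.Theses.CurrentTiltQuench.BoundedOddRigidity →
    Summit.AtomisticToContinuum.FouriersLaw.Theses.JunctionLocality.NonBallistic :=
  fun hK hU hQ hB =>
    Summit.AtomisticToContinuum.FouriersLaw.Theorems.NonBallistic.nonBallistic_of_extensiveSnapshotIrreversibility_of_noTruncatedDrude
      hK (Summit.AtomisticToContinuum.FouriersLaw.Theorems.CurrentTiltQuench.bridgeGlue_proof hU hQ hB)

/-- The same reduction for the `BondHeatUncertainty` copy of the decl (support item there; one statement, `Iff.rfl`). [folklore] -/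
theorem bondHeatUncertainty_nonBallistic_of_extensiveSnapshotIrreversibility_of_currentTiltQuenchCruxes :
    Summit.AtomisticToContinuum.FouriersLaw.Theses.BondHeatUncertainty.ExtensiveSnapshotIrreversibility →
    Summit.AtomisticToContinuum.FouriersLaw.Theses.CurrentTiltQuench.UniformQuadraticResponse →
    Summit.AtomisticToContinuum.FouriersLaw.Theses.CurrentTiltQuench.QuenchCurrentDies →
    Summit.AtomisticToContinuum.FouriersLaw.Theses.CurrentTiltQuench.BoundedOddRigidity →
    Summit.AtomisticToContinuum.FouriersLaw.Theses.BondHeatUncertainty.NonBallistic :=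
  nonBallistic_of_extensiveSnapshotIrreversibility_of_currentTiltQuenchCruxes

end Summit.AtomisticToContinuum.FouriersLaw.Theorems.NonBallistic
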